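import Mathlib

/-!
# The punctured-subgroup SDPP gadget (solo-blind seat, s59)

Let `G` be an abelian group, `H ⊆ G` a finite subgroup (given as a finite set containing `0`
and closed under subtraction) and `S ⊆ G ∖ H` a finite set meeting every coset of `H` at most
once.  Put `D = (S + H) ∖ S`.  The four pairs, in this order,

  `(P₀, Q₀) = (−D, {0})`, `(P₁, Q₁) = (−S, H ∖ {0})`, `(P₂, Q₂) = (−(H ∖ {0}), S)`,
  `(P₃, Q₃) = ({0}, D)`

form an *oriented SDPP gadget* with difference set `D` in the sense of
`SoloBlindSdppGadget.lean` (Cohn–Kleinberg–Szegedy–Umans 2005, Def. 20 / Thm. 23 after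
constant-composition powers):

* `soloPs_own`   : `Q i − P i ⊆ D` for every `i`;
* `soloPs_cross` : for `i < j` no element of `Q i − P j` lies in `D`;
* `soloPs_dpp`   : every pair has the double product property;
* `soloPs_card_D`, `soloPs_card_pair` : all four pairs are *exact*,
  `|P i| * |Q i| = |D| = |S| * (|H| − 1)`.

With `|H| = h`, `S` a full set of representatives of the `t − 1` non-trivial cosets
(`t = [G : H]`, `G` finite of order `m = t h`) the gadget has four exact pairs of size
`L = (t − 1)(h − 1)`, so its value `w` solves `4 · L^{w/2} = m^{3/2}` — the value of the product
of the two CKSU two-pair gadgets of orders `t` and `h` (Prop. 24 of the 2005 paper is the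
two-pair gadget of order `6`, value `2.4785`), realised however inside *every* abelian group of
order `t h`, cyclic ones included.  Example (kernel-checked below): `G = ℤ/20`, `H = 5ℤ/20`,
`S = {1, 2, 3, 4}`: four pairs of size `12`, `w = 2.5009`, better than the two-pair gadget of
order `20` (`w = 2.5814`).

More generally (pen, seat notes `work/sdpp58/GADGET.md` §7): if `(P_i, Q_i)_i` is any oriented
gadget of the subgroup `H` with difference set `D_H`, then the pairs `(−S + P_i, Q_i)_i` followed
by `(P_i, S + Q_i)_i` form an oriented gadget of `G` with difference set `S + D_H` (the *twisted
product* with the two-pair gadget of `G/H`); the present file is the case where the inner gadget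
is the two-pair gadget of `H`.  Hence `ρ(G) ≥ ρ(t) · ρ(H)` for the seat's extremal ratio `ρ`,
and iterating along a subgroup chain realises every product of two-pair values in every abelian
group of the right order.
-/

namespace Summit.MatrixMultiplication.MatrixMultiplication.Theorems

open Finset

variable {G : Type*} [AddCommGroup G] [DecidableEq G]

/-- The difference set `D = (S + H) ∖ S` of the punctured-subgroup gadget. -/
def soloPsD (H S : Finset G) : Finset G :=
  (S.biUnion fun s => H.image fun h => s + h) \ S

/-- Left sets: `P₀ = −D`, `P₁ = −S`, `P₂ = −(H ∖ {0})`, `P₃ = {0}`. -/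
def soloPsP (H S : Finset G) : Fin 4 → Finset G
  | 0 => (soloPsD H S).image fun x => -x
  | 1 => S.image fun x => -x
  | 2 => (H.erase 0).image fun x => -x
  | 3 => {0}

/-- Right sets: `Q₀ = {0}`, `Q₁ = H ∖ {0}`, `Q₂ = S`, `Q₃ = D`. -/
def soloPsQ (H S : Finset G) : Fin 4 → Finset G
  | 0 => {0}
  | 1 => H.erase 0
  | 2 => S
  | 3 => soloPsD H S

/-- Membership in `D = (S + H) ∖ S`. -/
theorem soloPs_mem_D {H S : Finset G} {x : G} :
    x ∈ soloPsD H S ↔ (∃ s ∈ S, ∃ h ∈ H, s + h = x) ∧ x ∉ S := by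
  unfold soloPsD
  simp only [Finset.mem_sdiff, Finset.mem_biUnion, Finset.mem_image]

/-- `s + h ∈ D` for `s ∈ S` and `0 ≠ h ∈ H`. -/
theorem soloPs_add_mem_D {H S : Finset G}
    (hS1 : ∀ s ∈ S, ∀ s' ∈ S, s - s' ∈ H → s = s')
    {s h : G} (hs : s ∈ S) (hh : h ∈ H) (hh0 : h ≠ 0) : s + h ∈ soloPsD H S := by
  rw [soloPs_mem_D]
  refine ⟨⟨s, hs, h, hh, rfl⟩, ?_⟩
  intro hmem
  have e : s + h = s := hS1 (s + h) hmem s hs (by simpa using hh)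
  apply hh0
  have : h = (s + h) - s := by abel
  rw [this, e, sub_self]

/-- `H` is disjoint from `D`. -/
theorem soloPs_not_mem_D_of_mem_H {H S : Finset G}
    (hsub : ∀ a ∈ H, ∀ b ∈ H, a - b ∈ H) (hSH : ∀ s ∈ S, s ∉ H)
    {x : G} (hx : x ∈ H) : x ∉ soloPsD H S := by
  rw [soloPs_mem_D]
  rintro ⟨⟨s, hs, h, hh, rfl⟩, -⟩
  exact hSH s hs (by simpa using hsub _ hx _ hh)

/-- `S` is disjoint from `D`. -/
theorem soloPs_not_mem_D_of_mem_S {H S : Finset G} {x : G} (hx : x ∈ S) :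
    x ∉ soloPsD H S := by
  rw [soloPs_mem_D]
  exact fun hD => hD.2 hx

/-- (G1, own differences) `Q i − P i ⊆ D` for each of the four pairs. -/
theorem soloPs_own {H S : Finset G}
    (hS1 : ∀ s ∈ S, ∀ s' ∈ S, s - s' ∈ H → s = s') :
    ∀ i, ∀ p ∈ soloPsP H S i, ∀ q ∈ soloPsQ H S i, q - p ∈ soloPsD H S := by
  intro i
  fin_cases i
  · show ∀ p ∈ (soloPsD H S).image (fun x => -x), ∀ q ∈ ({0} : Finset G),
      q - p ∈ soloPsD H S
    intro p hp q hq
    obtain ⟨x, hx, rfl⟩ := Finset.mem_image.1 hp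
    rw [Finset.mem_singleton] at hq
    subst hq
    simpa using hx
  · show ∀ p ∈ S.image (fun x => -x), ∀ q ∈ H.erase 0, q - p ∈ soloPsD H S
    intro p hp q hq
    obtain ⟨s, hs, rfl⟩ := Finset.mem_image.1 hp
    obtain ⟨hq0, hqH⟩ := Finset.mem_erase.1 hq
    have := soloPs_add_mem_D hS1 hs hqH hq0
    rw [add_comm] at this
    simpa using this
  · show ∀ p ∈ (H.erase 0).image (fun x => -x), ∀ q ∈ S, q - p ∈ soloPsD H S
    intro p hp q hq
    obtain ⟨h, hh, rfl⟩ := Finset.mem_image.1 hp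
    obtain ⟨hh0, hhH⟩ := Finset.mem_erase.1 hh
    simpa using soloPs_add_mem_D hS1 hq hhH hh0
  · show ∀ p ∈ ({0} : Finset G), ∀ q ∈ soloPsD H S, q - p ∈ soloPsD H S
    intro p hp q hq
    rw [Finset.mem_singleton] at hp
    subst hp
    simpa using hq

/-- (G1, cross differences) for `i < j` no element of `Q i − P j` lies in `D`. -/
theorem soloPs_cross {H S : Finset G}
    (h0 : (0 : G) ∈ H) (hsub : ∀ a ∈ H, ∀ b ∈ H, a - b ∈ H) (hSH : ∀ s ∈ S, s ∉ H) :
    ∀ i j, i < j → ∀ p ∈ soloPsP H S j, ∀ q ∈ soloPsQ H S i, q - p ∉ soloPsD H S := by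
  have hadd : ∀ a ∈ H, ∀ b ∈ H, a + b ∈ H := by
    intro a ha b hb
    have := hsub a ha (0 - b) (hsub 0 h0 b hb)
    simpa using this
  intro i j hij
  fin_cases i <;> fin_cases j
  all_goals first | exact absurd hij (by decide) | skip
  · show ∀ p ∈ S.image (fun x => -x), ∀ q ∈ ({0} : Finset G), q - p ∉ soloPsD H S
    intro p hp q hq
    obtain ⟨s, hs, rfl⟩ := Finset.mem_image.1 hp
    rw [Finset.mem_singleton] at hq
    subst hq
    simpa using soloPs_not_mem_D_of_mem_S (H := H) hs
  · show ∀ p ∈ (H.erase 0).image (fun x => -x), ∀ q ∈ ({0} : Finset G),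
      q - p ∉ soloPsD H S
    intro p hp q hq
    obtain ⟨h, hh, rfl⟩ := Finset.mem_image.1 hp
    rw [Finset.mem_singleton] at hq
    subst hq
    simpa using soloPs_not_mem_D_of_mem_H hsub hSH (Finset.mem_erase.1 hh).2
  · show ∀ p ∈ ({0} : Finset G), ∀ q ∈ ({0} : Finset G), q - p ∉ soloPsD H S
    intro p hp q hq
    rw [Finset.mem_singleton] at hp hq
    subst hp
    subst hq
    simpa using soloPs_not_mem_D_of_mem_H hsub hSH h0
  · show ∀ p ∈ (H.erase 0).image (fun x => -x), ∀ q ∈ H.erase 0, q - p ∉ soloPsD H S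
    intro p hp q hq
    obtain ⟨h, hh, rfl⟩ := Finset.mem_image.1 hp
    have hq' := (Finset.mem_erase.1 hq).2
    have hh' := (Finset.mem_erase.1 hh).2
    simpa using soloPs_not_mem_D_of_mem_H hsub hSH (hadd q hq' h hh')
  · show ∀ p ∈ ({0} : Finset G), ∀ q ∈ H.erase 0, q - p ∉ soloPsD H S
    intro p hp q hq
    rw [Finset.mem_singleton] at hp
    subst hp
    simpa using soloPs_not_mem_D_of_mem_H hsub hSH (Finset.mem_erase.1 hq).2
  · show ∀ p ∈ ({0} : Finset G), ∀ q ∈ S, q - p ∉ soloPsD H S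
    intro p hp q hq
    rw [Finset.mem_singleton] at hp
    subst hp
    simpa using soloPs_not_mem_D_of_mem_S (H := H) hq

/-- (G2) every pair has the double product property. -/
theorem soloPs_dpp {H S : Finset G}
    (hsub : ∀ a ∈ H, ∀ b ∈ H, a - b ∈ H)
    (hS1 : ∀ s ∈ S, ∀ s' ∈ S, s - s' ∈ H → s = s') :
    ∀ i, ∀ p ∈ soloPsP H S i, ∀ p' ∈ soloPsP H S i, ∀ q ∈ soloPsQ H S i, ∀ q' ∈ soloPsQ H S i,
      q - p = q' - p' → p = p' ∧ q = q' := by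
  intro i
  fin_cases i
  · show ∀ p ∈ (soloPsD H S).image (fun x => -x), ∀ p' ∈ (soloPsD H S).image (fun x => -x),
      ∀ q ∈ ({0} : Finset G), ∀ q' ∈ ({0} : Finset G), q - p = q' - p' → p = p' ∧ q = q'
    intro p _ p' _ q hq q' hq' hpq
    rw [Finset.mem_singleton] at hq hq'
    subst hq
    subst hq'
    exact ⟨by simpa using hpq, rfl⟩
  · show ∀ p ∈ S.image (fun x => -x), ∀ p' ∈ S.image (fun x => -x),
      ∀ q ∈ H.erase 0, ∀ q' ∈ H.erase 0, q - p = q' - p' → p = p' ∧ q = q'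
    intro p hp p' hp' q hq q' hq' hpq
    obtain ⟨s, hs, rfl⟩ := Finset.mem_image.1 hp
    obtain ⟨s', hs', rfl⟩ := Finset.mem_image.1 hp'
    have hqH := (Finset.mem_erase.1 hq).2
    have hq'H := (Finset.mem_erase.1 hq').2
    have e : q + s = q' + s' := by simpa using hpq
    have key : s - s' = q' - q := by
      have h1 : s - s' = (q + s) - q - s' := by abel
      rw [h1, e]
      abel
    have hss : s = s' := hS1 s hs s' hs' (key ▸ hsub q' hq'H q hqH)
    subst hss
    exact ⟨rfl, add_right_cancel e⟩
  · show ∀ p ∈ (H.erase 0).image (fun x => -x), ∀ p' ∈ (H.erase 0).image (fun x => -x),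
      ∀ q ∈ S, ∀ q' ∈ S, q - p = q' - p' → p = p' ∧ q = q'
    intro p hp p' hp' q hq q' hq' hpq
    obtain ⟨h, hh, rfl⟩ := Finset.mem_image.1 hp
    obtain ⟨h', hh', rfl⟩ := Finset.mem_image.1 hp'
    have hhH := (Finset.mem_erase.1 hh).2
    have hh'H := (Finset.mem_erase.1 hh').2
    have e : q + h = q' + h' := by simpa using hpq
    have key : q - q' = h' - h := by
      have h1 : q - q' = (q + h) - h - q' := by abel
      rw [h1, e]
      abel
    have hqq : q = q' := hS1 q hq q' hq' (key ▸ hsub h' hh'H h hhH)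
    subst hqq
    exact ⟨by rw [add_left_cancel e], rfl⟩
  · show ∀ p ∈ ({0} : Finset G), ∀ p' ∈ ({0} : Finset G),
      ∀ q ∈ soloPsD H S, ∀ q' ∈ soloPsD H S, q - p = q' - p' → p = p' ∧ q = q'
    intro p hp p' hp' q _ q' _ hpq
    rw [Finset.mem_singleton] at hp hp'
    subst hp
    subst hp'
    exact ⟨rfl, by simpa using hpq⟩

/-- `|D| = |S| * (|H| - 1)`: `S + H` is the disjoint union of the `|S|` translates `s + H`. -/
theorem soloPs_card_D {H S : Finset G}
    (h0 : (0 : G) ∈ H) (hsub : ∀ a ∈ H, ∀ b ∈ H, a - b ∈ H)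
    (hS1 : ∀ s ∈ S, ∀ s' ∈ S, s - s' ∈ H → s = s') :
    (soloPsD H S).card = S.card * (H.card - 1) := by
  classical
  have hcov : S ⊆ S.biUnion (fun s => H.image fun h => s + h) := by
    intro s hs
    rw [Finset.mem_biUnion]
    exact ⟨s, hs, Finset.mem_image.2 ⟨0, h0, by simp⟩⟩
  have hdisj : (S : Set G).PairwiseDisjoint (fun s => H.image fun h => s + h) := by
    intro s hs s' hs' hne
    change Disjoint (H.image fun h => s + h) (H.image fun h => s' + h)
    rw [Finset.disjoint_left]
    intro x hx hx'
    obtain ⟨a, ha, rfl⟩ := Finset.mem_image.1 hx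
    obtain ⟨b, hb, hab⟩ := Finset.mem_image.1 hx'
    apply hne
    refine hS1 s (Finset.mem_coe.1 hs) s' (Finset.mem_coe.1 hs') ?_
    have key : s - s' = b - a := by
      have h1 : s - s' = (s + a) - a - s' := by abel
      rw [h1, ← hab]
      abel
    rw [key]
    exact hsub b hb a ha
  have hU : (S.biUnion fun s => H.image fun h => s + h).card = S.card * H.card := by
    rw [Finset.card_biUnion hdisj]
    have : ∀ s ∈ S, (H.image fun h => s + h).card = H.card := by
      intro s _
      exact Finset.card_image_of_injective _ (add_right_injective s)
    rw [Finset.sum_congr rfl this, Finset.sum_const, smul_eq_mul]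
  unfold soloPsD
  rw [Finset.card_sdiff_of_subset hcov, hU, Nat.mul_sub_one]

/-- Every pair is exact: `|P i| * |Q i| = |S| * (|H| - 1)` (`= |D|` by `soloPs_card_D`). -/
theorem soloPs_card_pair {H S : Finset G}
    (h0 : (0 : G) ∈ H) (hsub : ∀ a ∈ H, ∀ b ∈ H, a - b ∈ H)
    (hS1 : ∀ s ∈ S, ∀ s' ∈ S, s - s' ∈ H → s = s') :
    ∀ i, (soloPsP H S i).card * (soloPsQ H S i).card = S.card * (H.card - 1) := by
  have hneg : ∀ T : Finset G, (T.image fun x => -x).card = T.card := fun T =>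
    Finset.card_image_of_injective _ neg_injective
  intro i
  fin_cases i
  · show ((soloPsD H S).image fun x => -x).card * ({0} : Finset G).card = _
    rw [hneg, Finset.card_singleton, mul_one, soloPs_card_D h0 hsub hS1]
  · show (S.image fun x => -x).card * (H.erase 0).card = _
    rw [hneg, Finset.card_erase_of_mem h0]
  · show ((H.erase 0).image fun x => -x).card * S.card = _
    rw [hneg, Finset.card_erase_of_mem h0, mul_comm]
  · show ({0} : Finset G).card * (soloPsD H S).card = _
    rw [Finset.card_singleton, one_mul, soloPs_card_D h0 hsub hS1]

/-- The example quoted in the module docstring, as a kernel check: in `ℤ/20` with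
`H = {0, 5, 10, 15}` and `S = {1, 2, 3, 4}` (one representative per non-trivial coset),
`|D| = 12` and the pair sizes are `12, 12, 12, 12` (value `w = 2.5009…`). -/
example :
    (soloPsD ({0, 5, 10, 15} : Finset (ZMod 20)) {1, 2, 3, 4}).card = 12 ∧
    ∀ i, (soloPsP ({0, 5, 10, 15} : Finset (ZMod 20)) {1, 2, 3, 4} i).card *
      (soloPsQ ({0, 5, 10, 15} : Finset (ZMod 20)) {1, 2, 3, 4} i).card = 12 := by
  decide

end Summit.MatrixMultiplication.MatrixMultiplication.Theorems
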